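import Summits.Ventures.Crystal3D.Theorems.StickyWulffConstantTextureLiminfTexShadowFaultedSameFrame
import Summits.Ventures.Crystal3D.Theorems.StickyWulffConstantTextureLiminfTexShadowSplitDefsV5
import HarnessLib

/-!
# The ONE-FCC F_layer cell, CHARGE SIDE: an admissible twin-family table charges only the strips of the faulted plate facing the fcc plate
# with the OTHER orientation, each at most `½·sin θ` (F_layer OneFcc, file (C) of HOME/wall-19481-p1/g15/ONEFCC-ASSEMBLY-PLAN-g15.md)

HONEST FRAMING. Venture `Summits/Ventures/Crystal3D` (cell `crystal3d-full`); helper `--supports` the law-v5 crux `TextureLiminfV5`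
(stmt-Ventures-23912), registered stub `stub_fLayerOneFcc : ∃ C, FLayerTwinFamilyOneFccAt (13/25) C 10` (TexShadow v8.4; owner 19481-p1,
cf-p1 (civ)/(cx)).  Measure bookkeeping only, standard axioms; nothing about the stub is claimed; F-C1 not moved.

In a OneFcc cell the fcc plate's bilayer lattices are all ONE member `D` of the twin family `{P '' Λ₀, (basalMirror ≫ P) '' Λ₀}` and the
faulted plate's are either; an ADMISSIBLE table (`BilayerChargeAdmissible`, …TexShadowSplitDefs) vanishes on equal lattices and is
`≤ ½·√(1 − ⟪m, e₃⟫²)` on co-axial distinct ones, whose shared axes are `±P e₃` (`frames_equal_or_coaxial_of_twinFamily`, p686700).  Hence,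
by the per-strip flux bound `charge_le_flux` (…TextureLiminfChargeFlux) with flux `√(1 − ⟪P e₃, e₃⟫²)` on the MISMATCHED strips of the
faulted plate and `0` elsewhere:
* **`two_charge_le_mismatch_of_twinFamily`** — `2·Σ' c_ij·|S ∩ slab₁ i ∩ slab₂ j| ≤ Σ'_i [A₁ i '' Λ₀ ≠ D]·√(1 − ⟪P e₃, e₃⟫²)·|S ∩ slab₁ i|`
  (faulted plate indexed FIRST; any finite-volume measurable `S`, e.g. the unit slice `wallSlice ρ`);
* `two_charge_le_mismatch_of_twinFamily_top` — the same with the fcc plate first and the faulted plate second (flux on `slab₂ j`);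
* `…At` corollaries for `BilayerChargeAdmissibleAt c₀` (`c₀ ≤ 1`).
This is the quantity the faulted plate's opposite-tree word net pays for (export `wordNet_barlow_endPairs_oneFcc`, p698172): its sources
live exactly on the layers bounding the mismatched strips from above.
WHAT THIS IS NOT: not the flux count, not the assembly; F-C1 not moved.
-/

noncomputable section

open scoped BigOperators InnerProductSpace ENNReal
open MeasureTheory

namespace Summit.Ventures.Crystal3D.Theorems

open Summit.Ventures.Crystal3D
open Literature.MathematicalPhysics.StatisticalMechanics (IsHaggSeq basalMirror)
open Summit.Ventures.Crystal3D.Cruxes.TextureLiminf.TexShadow (E3 e₃ fccRef laySlab SharedAxis CoAx BilayerChargeAdmissible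
  BilayerChargeAdmissibleAt bilayerChargeAdmissible_of_at)

open scoped Classical in
/-- **Per-strip charge cap of a OneFcc twin-family cell (faulted plate FIRST).**  If every bilayer lattice of plate 1 is in the twin
family of `P`, every bilayer lattice of plate 2 is the fixed member `D`, and the table is admissible, then
`2·Σ' c_ij·|S ∩ slab₁ i ∩ slab₂ j| ≤ Σ'_i (if A₁ i '' Λ₀ = D then 0 else √(1 − ⟪P e₃, e₃⟫²))·|S ∩ slab₁ i|`. -/
theorem two_charge_le_mismatch_of_twinFamily (L₁ L₂ : E3 ≃ₗᵢ[ℝ] E3) (s₁ s₂ : E3) {P : E3 ≃ₗᵢ[ℝ] E3}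
    {A₁ A₂ : ℤ → (E3 ≃ₗᵢ[ℝ] E3)} {D : Set E3}
    (h₁ : ∀ i, A₁ i '' fccRef = P '' fccRef ∨ A₁ i '' fccRef = (basalMirror.trans P) '' fccRef)
    (hD : D = P '' fccRef ∨ D = (basalMirror.trans P) '' fccRef) (h₂ : ∀ j, A₂ j '' fccRef = D)
    {c : ℤ → ℤ → ℝ} {m : ℤ → ℤ → E3} (hadm : BilayerChargeAdmissible A₁ A₂ c m)
    (S : Set E3) (hS : MeasurableSet S) (hSfin : volume S ≠ ⊤) :
    2 * ∑' ij : ℤ × ℤ, c ij.1 ij.2 * (volume (S ∩ laySlab L₁ s₁ ij.1 ∩ laySlab L₂ s₂ ij.2)).toReal ≤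
      ∑' i : ℤ, (if A₁ i '' fccRef = D then 0 else Real.sqrt (1 - ⟪P e₃, e₃⟫_ℝ ^ 2)) *
        (volume (S ∩ laySlab L₁ s₁ i)).toReal := by
  set θ : ℝ := Real.sqrt (1 - ⟪P e₃, e₃⟫_ℝ ^ 2) with hθ
  have hθ0 : 0 ≤ θ := Real.sqrt_nonneg _
  have hθ1 : θ ≤ 1 := by
    rw [hθ, show (1 : ℝ) = Real.sqrt 1 from Real.sqrt_one.symm]
    exact Real.sqrt_le_sqrt (by rw [Real.sqrt_one]; nlinarith [sq_nonneg ⟪P e₃, e₃⟫_ℝ])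
  have h₂' : ∀ j, A₂ j '' fccRef = P '' fccRef ∨ A₂ j '' fccRef = (basalMirror.trans P) '' fccRef := by
    intro j; rw [h₂ j]; exact hD
  have hax := frames_equal_or_coaxial_of_twinFamily h₁ h₂'
  set κ₁ : ℤ → ℝ := fun i => if A₁ i '' fccRef = D then 0 else θ with hκ₁
  have hκ₁0 : ∀ i, 0 ≤ κ₁ i := fun i => by
    simp only [hκ₁]; split_ifs
    · exact le_rfl
    · exact hθ0
  have hκ₁1 : ∀ i, κ₁ i ≤ 1 := fun i => by
    simp only [hκ₁]; split_ifs
    · exact zero_le_one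
    · exact hθ1
  have hdom : ∀ i j, c i j ≤ (κ₁ i + (fun _ : ℤ => (0 : ℝ)) j) / 2 := by
    intro i j
    simp only [hκ₁, add_zero]
    split_ifs with heq
    · -- equal lattices: no charge
      have : c i j = 0 := hadm.2.2.2 i j (by rw [heq, h₂ j])
      rw [this]; norm_num
    · -- distinct members of the twin family: co-axial about `±P e₃`
      have hne : A₁ i '' fccRef ≠ A₂ j '' fccRef := by rw [h₂ j]; exact heq
      rcases hax i j with h | ⟨hco, hsin⟩
      · exact absurd h hne
      · obtain ⟨hsh, hc⟩ := hadm.2.2.1 i j hco hne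
        have := hsin (m i j) hsh
        linarith
  have key := charge_le_flux L₁ L₂ s₁ s₂ κ₁ (fun _ => 0) c 1 hκ₁0 hκ₁1 (fun _ => le_rfl) (fun _ => zero_le_one) hadm.1
    hdom S hS hSfin
  simp only [zero_mul, tsum_zero, add_zero] at key
  exact key

open scoped Classical in
/-- **Per-strip charge cap of a OneFcc twin-family cell (fcc plate FIRST, faulted plate second).** -/
theorem two_charge_le_mismatch_of_twinFamily_top (L₁ L₂ : E3 ≃ₗᵢ[ℝ] E3) (s₁ s₂ : E3) {P : E3 ≃ₗᵢ[ℝ] E3}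
    {A₁ A₂ : ℤ → (E3 ≃ₗᵢ[ℝ] E3)} {D : Set E3}
    (hD : D = P '' fccRef ∨ D = (basalMirror.trans P) '' fccRef) (h₁ : ∀ i, A₁ i '' fccRef = D)
    (h₂ : ∀ j, A₂ j '' fccRef = P '' fccRef ∨ A₂ j '' fccRef = (basalMirror.trans P) '' fccRef)
    {c : ℤ → ℤ → ℝ} {m : ℤ → ℤ → E3} (hadm : BilayerChargeAdmissible A₁ A₂ c m)
    (S : Set E3) (hS : MeasurableSet S) (hSfin : volume S ≠ ⊤) :
    2 * ∑' ij : ℤ × ℤ, c ij.1 ij.2 * (volume (S ∩ laySlab L₁ s₁ ij.1 ∩ laySlab L₂ s₂ ij.2)).toReal ≤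
      ∑' j : ℤ, (if A₂ j '' fccRef = D then 0 else Real.sqrt (1 - ⟪P e₃, e₃⟫_ℝ ^ 2)) *
        (volume (S ∩ laySlab L₂ s₂ j)).toReal := by
  set θ : ℝ := Real.sqrt (1 - ⟪P e₃, e₃⟫_ℝ ^ 2) with hθ
  have hθ0 : 0 ≤ θ := Real.sqrt_nonneg _
  have hθ1 : θ ≤ 1 := by
    rw [hθ, show (1 : ℝ) = Real.sqrt 1 from Real.sqrt_one.symm]
    exact Real.sqrt_le_sqrt (by rw [Real.sqrt_one]; nlinarith [sq_nonneg ⟪P e₃, e₃⟫_ℝ])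
  have h₁' : ∀ i, A₁ i '' fccRef = P '' fccRef ∨ A₁ i '' fccRef = (basalMirror.trans P) '' fccRef := by
    intro i; rw [h₁ i]; exact hD
  have hax := frames_equal_or_coaxial_of_twinFamily h₁' h₂
  set κ₂ : ℤ → ℝ := fun j => if A₂ j '' fccRef = D then 0 else θ with hκ₂
  have hκ₂0 : ∀ j, 0 ≤ κ₂ j := fun j => by
    simp only [hκ₂]; split_ifs
    · exact le_rfl
    · exact hθ0
  have hκ₂1 : ∀ j, κ₂ j ≤ 1 := fun j => by
    simp only [hκ₂]; split_ifs
    · exact zero_le_one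
    · exact hθ1
  have hdom : ∀ i j, c i j ≤ ((fun _ : ℤ => (0 : ℝ)) i + κ₂ j) / 2 := by
    intro i j
    simp only [hκ₂, zero_add]
    split_ifs with heq
    · have : c i j = 0 := hadm.2.2.2 i j (by rw [heq, h₁ i])
      rw [this]; norm_num
    · have hne : A₁ i '' fccRef ≠ A₂ j '' fccRef := by rw [h₁ i]; exact Ne.symm heq
      rcases hax i j with h | ⟨hco, hsin⟩
      · exact absurd h hne
      · obtain ⟨hsh, hc⟩ := hadm.2.2.1 i j hco hne
        have := hsin (m i j) hsh
        linarith
  have key := charge_le_flux L₁ L₂ s₁ s₂ (fun _ => 0) κ₂ c 1 (fun _ => le_rfl) (fun _ => zero_le_one) hκ₂0 hκ₂1 hadm.1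
    hdom S hS hSfin
  simp only [zero_mul, tsum_zero, zero_add] at key
  exact key

open scoped Classical in
/-- The `At` form (cap `c₀ ≤ 1`), faulted plate first. -/
theorem two_charge_le_mismatch_of_twinFamilyAt {c₀ : ℝ} (hc₀ : c₀ ≤ 1) (L₁ L₂ : E3 ≃ₗᵢ[ℝ] E3) (s₁ s₂ : E3)
    {P : E3 ≃ₗᵢ[ℝ] E3} {A₁ A₂ : ℤ → (E3 ≃ₗᵢ[ℝ] E3)} {D : Set E3}
    (h₁ : ∀ i, A₁ i '' fccRef = P '' fccRef ∨ A₁ i '' fccRef = (basalMirror.trans P) '' fccRef)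
    (hD : D = P '' fccRef ∨ D = (basalMirror.trans P) '' fccRef) (h₂ : ∀ j, A₂ j '' fccRef = D)
    {c : ℤ → ℤ → ℝ} {m : ℤ → ℤ → E3} (hadm : BilayerChargeAdmissibleAt c₀ A₁ A₂ c m)
    (S : Set E3) (hS : MeasurableSet S) (hSfin : volume S ≠ ⊤) :
    2 * ∑' ij : ℤ × ℤ, c ij.1 ij.2 * (volume (S ∩ laySlab L₁ s₁ ij.1 ∩ laySlab L₂ s₂ ij.2)).toReal ≤
      ∑' i : ℤ, (if A₁ i '' fccRef = D then 0 else Real.sqrt (1 - ⟪P e₃, e₃⟫_ℝ ^ 2)) *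
        (volume (S ∩ laySlab L₁ s₁ i)).toReal :=
  two_charge_le_mismatch_of_twinFamily L₁ L₂ s₁ s₂ h₁ hD h₂ (bilayerChargeAdmissible_of_at hc₀ hadm) S hS hSfin

open scoped Classical in
/-- The `At` form (cap `c₀ ≤ 1`), fcc plate first. -/
theorem two_charge_le_mismatch_of_twinFamilyAt_top {c₀ : ℝ} (hc₀ : c₀ ≤ 1) (L₁ L₂ : E3 ≃ₗᵢ[ℝ] E3) (s₁ s₂ : E3)
    {P : E3 ≃ₗᵢ[ℝ] E3} {A₁ A₂ : ℤ → (E3 ≃ₗᵢ[ℝ] E3)} {D : Set E3}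
    (hD : D = P '' fccRef ∨ D = (basalMirror.trans P) '' fccRef) (h₁ : ∀ i, A₁ i '' fccRef = D)
    (h₂ : ∀ j, A₂ j '' fccRef = P '' fccRef ∨ A₂ j '' fccRef = (basalMirror.trans P) '' fccRef)
    {c : ℤ → ℤ → ℝ} {m : ℤ → ℤ → E3} (hadm : BilayerChargeAdmissibleAt c₀ A₁ A₂ c m)
    (S : Set E3) (hS : MeasurableSet S) (hSfin : volume S ≠ ⊤) :
    2 * ∑' ij : ℤ × ℤ, c ij.1 ij.2 * (volume (S ∩ laySlab L₁ s₁ ij.1 ∩ laySlab L₂ s₂ ij.2)).toReal ≤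
      ∑' j : ℤ, (if A₂ j '' fccRef = D then 0 else Real.sqrt (1 - ⟪P e₃, e₃⟫_ℝ ^ 2)) *
        (volume (S ∩ laySlab L₂ s₂ j)).toReal :=
  two_charge_le_mismatch_of_twinFamily_top L₁ L₂ s₁ s₂ hD h₁ h₂ (bilayerChargeAdmissible_of_at hc₀ hadm) S hS hSfin

end Summit.Ventures.Crystal3D.Theorems

end
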